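import Literature.NumberTheory.ModularForms.JacobiThetaGammaTwo
import Literature.NumberTheory.ModularForms.ModerateGrowth
import HarnessLib

/-!
# The theta forms `U`, `V`, `W` have moderate growth (`U, V, W ∈ 𝓟`)

Cohn–Kumar–Miller–Radchenko–Viazovska, Ann. of Math. 196 (2022) = arXiv:1902.05438, §4.1: the
bound (4.1) `|F(τ)| ≤ α(Im(τ)^{−β} + |τ|^γ)` "is satisfied by any power series in `e^{πiτ}` whose
coefficients grow more slowly than some polynomial (e.g., the classical modular forms `E_k` and
theta functions from Section 2.1)". PROVED here for `U = θ₀₀⁴`, `V = θ₁₀⁴`, `W = θ₀₁⁴`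
(`isClassP_thetaU`, `isClassP_thetaV`, `isClassP_thetaW`): `|θ₀₀(τ)| ≤ 1 + 2/(π Im τ)` from
Mathlib's tail bound for the Jacobi theta function, then `W = U|₂T` (slash stability of `𝓟`,
`ModerateGrowth.lean`) and `V = U − W` (Jacobi).

## References

* H. Cohn, A. Kumar, S. D. Miller, D. Radchenko, M. Viazovska, Ann. of Math. 196 (2022),
  arXiv:1902.05438, §4.1 (sentence after (4.1)). [CohnEtAl2019]
-/

noncomputable section

open Complex hiding I
open Filter Topology ModularForm SlashInvariantForm
open UpperHalfPlane hiding I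
open Complex (I)
open scoped Real MatrixGroups ModularForm Manifold

namespace Literature.NumberTheory.ModularForms

open Literature.NumberTheory.EllipticCurves.JacobiThetaNull

/-- **`|θ₀₀(τ)| ≤ 1 + 2/(π Im τ)`** (`|θ₀₀ − 1| ≤ 2e^{−πy}/(1 − e^{−πy}) = 2/(e^{πy} − 1) ≤ 2/(πy)`,
`y = Im τ`). [folklore] -/
theorem norm_theta3_le (τ : ℍ) : ‖theta3 τ‖ ≤ 1 + 2 / (π * τ.im) := by
  have hy : 0 < τ.im := τ.im_pos
  have hy' : 0 < (τ : ℂ).im := by simpa using hy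
  have h := norm_jacobiTheta_sub_one_le hy'
  rw [UpperHalfPlane.coe_im] at h
  have h3 : theta3 (τ : ℂ) = jacobiTheta (τ : ℂ) := by
    rw [theta3, jacobiTheta_eq_jacobiTheta₂]
  rw [h3]
  have hx : 0 < π * τ.im := mul_pos Real.pi_pos hy
  have he : Real.exp (-π * τ.im) < 1 := by
    rw [Real.exp_lt_one_iff]; nlinarith
  have he0 : 0 < 1 - Real.exp (-π * τ.im) := by linarith
  -- `2/(1 - e^{-x}) · e^{-x} ≤ 2/x` for `x = π y > 0`, i.e. `x e^{-x} ≤ 1 - e^{-x}`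
  have key : 2 / (1 - Real.exp (-π * τ.im)) * Real.exp (-π * τ.im) ≤ 2 / (π * τ.im) := by
    rw [div_mul_eq_mul_div, div_le_div_iff₀ he0 hx]
    have h2 := Real.add_one_le_exp (π * τ.im)
    have h3 : Real.exp (-π * τ.im) * Real.exp (π * τ.im) = 1 := by
      rw [← Real.exp_add]; simp
    nlinarith [Real.exp_pos (-π * τ.im)]
  calc ‖jacobiTheta (τ : ℂ)‖ = ‖(jacobiTheta (τ : ℂ) - 1) + 1‖ := by rw [sub_add_cancel]
    _ ≤ ‖jacobiTheta (τ : ℂ) - 1‖ + ‖(1 : ℂ)‖ := norm_add_le _ _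
    _ ≤ 2 / (π * τ.im) + 1 := by rw [norm_one]; exact add_le_add_left (h.trans key) 1
    _ = 1 + 2 / (π * τ.im) := add_comm _ _

/-- `θ₀₀` (restricted to `ℍ`) has moderate growth. [cite: CohnEtAl2019, §4.1] -/
theorem hasModerateGrowth_theta3 : HasModerateGrowth fun τ : ℍ => theta3 τ := by
  refine hasModerateGrowth_of_le (1 + 2 / π) 1 fun τ => (norm_theta3_le τ).trans ?_
  have hπ : 0 < π := Real.pi_pos
  have h1 : 1 ≤ growthGauge τ := one_le_growthGauge τ
  have h2 : τ.im⁻¹ ≤ growthGauge τ := inv_im_le_growthGauge τ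
  rw [pow_one, mul_comm π, ← div_div, div_eq_mul_inv _ π]
  have : τ.im⁻¹ * 2 * π⁻¹ ≤ growthGauge τ * (2 / π) := by
    rw [div_eq_mul_inv]
    nlinarith [inv_pos.2 hπ]
  calc 1 + 2 / τ.im * π⁻¹ = 1 + τ.im⁻¹ * 2 * π⁻¹ := by ring
    _ ≤ growthGauge τ + growthGauge τ * (2 / π) := add_le_add h1 this
    _ = (1 + 2 / π) * growthGauge τ := by ring

/-- **`U = θ₀₀⁴ ∈ 𝓟`.** [cite: CohnEtAl2019, §4.1] -/
theorem isClassP_thetaU : IsClassP thetaU :=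
  ⟨mdifferentiable_thetaU, by
    have h := hasModerateGrowth_theta3.pow 4
    rwa [show ((fun τ : ℍ => theta3 τ) ^ 4) = thetaU from rfl] at h⟩

/-- **`W = θ₀₁⁴ ∈ 𝓟`** (`W = U|₂T`). [cite: CohnEtAl2019, §4.1] -/
theorem isClassP_thetaW : IsClassP thetaW := by
  rw [← thetaU_slash_T]
  exact isClassP_thetaU.slash 2 ModularGroup.T

/-- **`V = θ₁₀⁴ ∈ 𝓟`** (`V = U − W`). [cite: CohnEtAl2019, §4.1] -/
theorem isClassP_thetaV : IsClassP thetaV := by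
  have h : thetaV = thetaU - thetaW := by rw [thetaU_eq_thetaV_add_thetaW, add_sub_cancel_right]
  rw [h]
  exact isClassP_thetaU.sub isClassP_thetaW

/-- `U² + W² − 2V²` and `U + W` (the `ξ₄`, `ξ₂` of CKMRV Prop. 4.3) are in `𝓟`. [cite: CohnEtAl2019, §4.2 Proposition 4.3] -/
theorem isClassP_xi :
    IsClassP (thetaU ^ 2 + thetaW ^ 2 - (2 : ℂ) • thetaV ^ 2) ∧ IsClassP (thetaU + thetaW) :=
  ⟨((isClassP_thetaU.pow 2).add (isClassP_thetaW.pow 2)).sub ((isClassP_thetaV.pow 2).smul 2),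
    isClassP_thetaU.add isClassP_thetaW⟩

end Literature.NumberTheory.ModularForms
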